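import Summits.RiemannHypothesis.RiemannHypothesis.Theorems.WeilFormatCDeflatedFarEnvelope
import Summits.RiemannHypothesis.RiemannHypothesis.Theorems.WeilFormatCDeflatedFarEntryLimits
import Summits.RiemannHypothesis.RiemannHypothesis.Theorems.WeilFormatCDeflatedFarSectorEven
import Summits.RiemannHypothesis.RiemannHypothesis.Theorems.WeilFormatCDeflatedFarSectorDecay
import Summits.RiemannHypothesis.RiemannHypothesis.Theorems.WeilFormatCKernelEnvelope
import Summits.RiemannHypothesis.RiemannHypothesis.Theorems.WeilFormatCCertificate
import HarnessLib

/-!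
# Format C, design C∞: the EVEN-sector certificate with limit data — all analytic hypotheses discharged

Route context: Fourier–Galerkin / Schur-complement certificates of Weil positivity on a window ("format C";
cell memo `run/shared/lean/pub/rh-explicit/rh-explicit-weil-10/KERNEL-LEVER.md` §17–§19; supporting
stmt-RiemannHypothesis-0098; seat rh-explicit-weil-10).

`sum_range_mul_mul_nonneg_of_certificate_cinf` instantiated on the EVEN sector kernel of Yoshida's matrix
`M⁺(n,m) = [n = 0] G(0,m) ; [m = 0] G(n,0) ; (G(n,m) + G(n,−m))/2`, `G = gramCoeff a`, with `r` EVEN REAL PROFILES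
`1f_j` (`f_j ∈ C³`, even, real-valued, `f_j′(−a) = f_j′(a)`), block `[0, B'+1)` and the real profile table
`V(n,j) = d_n² Re ĉ_n(1f_j)/√(2a)`.  Every ANALYTIC hypothesis of the abstract theorem is discharged here:
the kernel envelope (`exists_evenKernel_gramCoeff_envelope`), the cube decay of the table (`exists_evenTable_le_cube`),
the limit images `c∞(m,j) = Re W_a(1f_j − proj_{B'}1f_j, w⁺_m)/d_m` and band entries
`G∞(j,j') = Re W_a(1f_j − proj_{B'}1f_j, 1f_{j'} − proj_{B'}1f_{j'})` (`WeilFormatCDeflatedFarSectorEven`), and the series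
`E∞`, `A∞`, `ρ∞`, `σ∞` (`WeilFormatCDeflatedFarSectorDecay`, `WeilFormatCDeflatedFarEntryLimits`).  What remains are DATA
hypotheses: a far diagonal `d̂ ≥ d₀ > 0` with its far inequality for `M⁺` (e.g. `gramCoeff_even_far_ge_diag_A`), a free map
`Λ` with `Σ_j|Λ_j| ≤ λ(Σ|x_i| + Σ|β_j|)`, a majorant `Uq` of the LIMIT coupling, and one kernel inequality with margin `δ`.

* `evenKernel_nonneg_of_certificate_cinf` — conclusion `0 ≤ Σ_{n,m<K} y_n y_m M⁺(n,m)` for every `K`, `y`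
  (the even hypothesis of `weilPositivityOn_of_sector_kernels_nonneg`).

Standard axioms; no definitions; no RH claim.
-/

set_option autoImplicit false
-- `Summit.RiemannHypothesis.RiemannHypothesis.…` is the layout-mandated namespace (summit = problem name).
set_option linter.dupNamespace false

noncomputable section

open Complex Filter Set MeasureTheory Finset
open scoped Real Topology ComplexConjugate

namespace Summit.RiemannHypothesis.RiemannHypothesis.Theorems.WeilFormatC

open Literature.NumberTheory.LFunctions Literature.NumberTheory.LFunctions.Yoshida1992

variable {a : ℝ}

/-- **The even-sector C∞ certificate.**  See the module docstring; the limit objects appear verbatim in the data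
hypotheses `hUq` (majorant of the limit coupling) and `hS` (kernel inequality with margin `δ`). -/
theorem evenKernel_nonneg_of_certificate_cinf (ha : 0 < a) (B' : ℕ) {r : ℕ} (f : Fin r → ℝ → ℂ)
    (hf : ∀ j, ContDiff ℝ 3 (f j)) (hfe : ∀ j x, f j (-x) = f j x) (hfr : ∀ j x, conj (f j x) = f j x)
    (hf1 : ∀ j, deriv (f j) (-a) = deriv (f j) a)
    -- DATA: far diagonal with floor and far inequality
    (dhat : ℕ → ℝ) {d₀ : ℝ} (hd₀ : 0 < d₀) (hd : ∀ m, B' + 1 ≤ m → d₀ ≤ dhat m)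
    (hfar : ∀ (N : ℕ) (y : ℕ → ℝ),
      ∑ n ∈ Finset.Ico (B' + 1) N, dhat n * y n ^ 2 ≤ ∑ n ∈ Finset.Ico (B' + 1) N, ∑ m ∈ Finset.Ico (B' + 1) N,
        y n * (if n = 0 then gramCoeff a 0 m else if m = 0 then gramCoeff a n 0
          else (gramCoeff a n m + gramCoeff a n (-(m : ℤ))) / 2) * y m)
    -- DATA: free map, coupling majorant, margin
    (Λ : (Fin (B' + 1) → ℝ) → (Fin r → ℝ) → Fin r → ℝ) {lam : ℝ} (hlam : 0 ≤ lam)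
    (hΛ : ∀ (x : Fin (B' + 1) → ℝ) (β : Fin r → ℝ), ∑ j, |Λ x β j| ≤ lam * (∑ i, |x i| + ∑ j, |β j|))
    (Uq : (Fin (B' + 1) → ℝ) → (Fin r → ℝ) → ℝ)
    (hUq : ∀ (N : ℕ) (x : Fin (B' + 1) → ℝ) (β : Fin r → ℝ),
      ∑ m ∈ Finset.Ico (B' + 1) N,
        (∑ i : Fin (B' + 1), (if (i : ℕ) = 0 then gramCoeff a 0 m else if m = 0 then gramCoeff a i 0
            else (gramCoeff a i m + gramCoeff a i (-(m : ℤ))) / 2) * x i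
          + ∑ j, ((weilWindowSesq a ((Icc (-a) a).indicator (f j) - proj a B' ((Icc (-a) a).indicator (f j)))
              (chiEven a m)).re / (if m = 0 then 1 else Real.sqrt 2)) * β j) ^ 2 / dhat m ≤ Uq x β)
    {δ : ℝ} (hδ : 0 < δ)
    (hS : ∀ (x : Fin (B' + 1) → ℝ) (β : Fin r → ℝ),
      δ * (∑ i, x i ^ 2 + ∑ j, β j ^ 2) ≤
        ((∑ i : Fin (B' + 1), ∑ i' : Fin (B' + 1), x i * x i' *
            (if (i : ℕ) = 0 then gramCoeff a 0 i' else if (i' : ℕ) = 0 then gramCoeff a i 0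
              else (gramCoeff a i i' + gramCoeff a i (-(i' : ℤ))) / 2))
          + 2 * (∑ i : Fin (B' + 1), ∑ j : Fin r, x i * β j *
            ((weilWindowSesq a ((Icc (-a) a).indicator (f j) - proj a B' ((Icc (-a) a).indicator (f j)))
              (chiEven a i)).re / (if (i : ℕ) = 0 then 1 else Real.sqrt 2)))
          + (∑ j : Fin r, ∑ j' : Fin r, β j * β j' *
            (weilWindowSesq a ((Icc (-a) a).indicator (f j) - proj a B' ((Icc (-a) a).indicator (f j)))
              ((Icc (-a) a).indicator (f j') - proj a B' ((Icc (-a) a).indicator (f j')))).re))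
        - Uq x β
        + ((2 * ∑ j, Λ x β j *
            ((β j - ∑ j', (∑' n : ℕ, if B' + 1 ≤ n then
                ((if n = 0 then 1 else 2) * (Yoshida1992.fourierCoeff a n ((Icc (-a) a).indicator (f j))).re /
                  Real.sqrt (2 * a)) *
                ((if n = 0 then 1 else 2) * (Yoshida1992.fourierCoeff a n ((Icc (-a) a).indicator (f j'))).re /
                  Real.sqrt (2 * a)) else 0) * β j')
            + (∑ i : Fin (B' + 1), (∑' m : ℕ, if B' + 1 ≤ m then
                ((if m = 0 then 1 else 2) * (Yoshida1992.fourierCoeff a m ((Icc (-a) a).indicator (f j))).re /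
                  Real.sqrt (2 * a)) *
                (if (i : ℕ) = 0 then gramCoeff a 0 m else if m = 0 then gramCoeff a i 0
                  else (gramCoeff a i m + gramCoeff a i (-(m : ℤ))) / 2) / dhat m else 0) * x i
              + ∑ j'', (∑' m : ℕ, if B' + 1 ≤ m then
                ((if m = 0 then 1 else 2) * (Yoshida1992.fourierCoeff a m ((Icc (-a) a).indicator (f j))).re /
                  Real.sqrt (2 * a)) *
                ((weilWindowSesq a ((Icc (-a) a).indicator (f j'') - proj a B' ((Icc (-a) a).indicator (f j'')))
                  (chiEven a m)).re / (if m = 0 then 1 else Real.sqrt 2)) / dhat m else 0) * β j'')))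
          - ∑ j, ∑ j', Λ x β j * Λ x β j' *
            (∑' m : ℕ, if B' + 1 ≤ m then
              ((if m = 0 then 1 else 2) * (Yoshida1992.fourierCoeff a m ((Icc (-a) a).indicator (f j))).re /
                Real.sqrt (2 * a)) *
              ((if m = 0 then 1 else 2) * (Yoshida1992.fourierCoeff a m ((Icc (-a) a).indicator (f j'))).re /
                Real.sqrt (2 * a)) / dhat m else 0)))
    (K : ℕ) (y : ℕ → ℝ) :
    0 ≤ ∑ n ∈ Finset.range K, ∑ m ∈ Finset.range K, y n * y m *
      (if n = 0 then gramCoeff a 0 m else if m = 0 then gramCoeff a n 0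
        else (gramCoeff a n m + gramCoeff a n (-(m : ℤ))) / 2) := by
  have hB : 1 ≤ B' + 1 := Nat.le_add_left 1 B'
  -- the kernel envelope
  obtain ⟨C₀, C₁, hC₀, hC₁, hoff, hdiag⟩ := exists_evenKernel_gramCoeff_envelope ha
  -- cube decay of the tables, one constant for all profiles
  have hfe₀ : ∀ j, f j (-a) = f j a := fun j ↦ hfe j a
  choose Kj hKj0 hKj using fun j ↦ exists_evenTable_le_cube ha (hf j) (hfe₀ j) (hf1 j)
  set Kt : ℝ := ∑ j, Kj j with hKt
  have hKt0 : 0 ≤ Kt := Finset.sum_nonneg fun j _ ↦ hKj0 j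
  have hV : ∀ (n : ℕ) (j : Fin r), B' + 1 ≤ n →
      |(if n = 0 then 1 else 2) * (Yoshida1992.fourierCoeff a n ((Icc (-a) a).indicator (f j))).re /
        Real.sqrt (2 * a)| ≤ Kt / (n : ℝ) ^ 3 := by
    intro n j hn
    have h := hKj j n (hB.trans hn)
    have hle : Kj j ≤ Kt := Finset.single_le_sum (fun j _ ↦ hKj0 j) (Finset.mem_univ j)
    exact h.trans (div_le_div_of_nonneg_right hle (by positivity))
  -- kernel rows and band entries converge (sector bookkeeping)
  have hc : ∀ (m : ℕ) (j : Fin r), Tendsto (fun P ↦ ∑ n ∈ Finset.Ico (B' + 1) P,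
      (if n = 0 then gramCoeff a 0 m else if m = 0 then gramCoeff a n 0
        else (gramCoeff a n m + gramCoeff a n (-(m : ℤ))) / 2) *
        ((if n = 0 then 1 else 2) * (Yoshida1992.fourierCoeff a n ((Icc (-a) a).indicator (f j))).re /
          Real.sqrt (2 * a))) atTop
      (𝓝 ((weilWindowSesq a ((Icc (-a) a).indicator (f j) - proj a B' ((Icc (-a) a).indicator (f j)))
        (chiEven a m)).re / (if m = 0 then 1 else Real.sqrt 2))) :=
    fun m j ↦ tendsto_sum_Ico_evenKernel_mul ha (hf j) (hfe j) (hfr j) (hf1 j) B' m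
  refine sum_range_mul_mul_nonneg_of_certificate_cinf
    (fun n m : ℕ ↦ (if n = 0 then gramCoeff a 0 m else if m = 0 then gramCoeff a n 0
      else (gramCoeff a n m + gramCoeff a n (-(m : ℤ))) / 2))
    (fun n m ↦ evenKernel_symm (gramCoeff a) (gramCoeff_comm a) (gramCoeff_neg_neg a) n m) hB
    (fun (n : ℕ) (j : Fin r) ↦ (if n = 0 then 1 else 2) *
      (Yoshida1992.fourierCoeff a n ((Icc (-a) a).indicator (f j))).re / Real.sqrt (2 * a))
    dhat hd₀ hC₀ hC₁ zero_le_one hKt0 hd hfar hoff (fun n ↦ by rw [one_mul]; exact hdiag n) hV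
    (fun (m : ℕ) (j : Fin r) ↦ (weilWindowSesq a ((Icc (-a) a).indicator (f j) - proj a B' ((Icc (-a) a).indicator (f j)))
      (chiEven a m)).re / (if m = 0 then 1 else Real.sqrt 2))
    hc _ (fun j j' ↦ tendsto_sum_Ico_Ico_evenKernel ha (hf j) (hfe j) (hfr j) (hf1 j) (hf j') (hfe j') (hfr j')
      (hf1 j') B') _ _ _ _
    (fun j j' ↦ tendsto_sum_Ico_mul_of_cube hB hKt0 hKt0 (fun n hn ↦ hV n j hn) (fun n hn ↦ hV n j' hn))
    (fun j j' ↦ tendsto_weightedGram hB hd₀ hKt0 hd hV j j')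
    (fun j i ↦ tendsto_weightedBlock hB hd₀ hC₀ hKt0 hd hoff hV j i)
    (fun j j'' ↦ tendsto_weightedImage_finite hB hd₀ hC₀ hC₁ zero_le_one hKt0 hd hoff
      (fun n ↦ by rw [one_mul]; exact hdiag n) hV (fun m j _ ↦ hc m j) j j'')
    Λ hlam hΛ Uq hUq hδ hS K y

end Summit.RiemannHypothesis.RiemannHypothesis.Theorems.WeilFormatC

end
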